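import Mathlib.Analysis.SpecialFunctions.Integrals.Basic
import Mathlib.Analysis.SpecialFunctions.Trigonometric.Bounds
import Mathlib.Analysis.Complex.Trigonometric
import Mathlib.Algebra.Field.GeomSum
import Mathlib.MeasureTheory.Integral.IntervalIntegral.Periodic
import Mathlib.MeasureTheory.Integral.IntervalIntegral.IntegrationByParts
import Mathlib.MeasureTheory.Integral.IntervalIntegral.FundThmCalculus
import Mathlib.MeasureTheory.Function.Floor
import Literature.Probability.LatticeModels.FejerKernel
import HarnessLib

/-!
# An Erdős–Turán inequality for the discrepancy of points on the circle against a density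
# (Fejér-kernel smoothing; Murty–Sinha's Theorem 8)

Written for `Literature.NumberTheory.EllipticCurves.MurtySinhaEquidistribution`, which vendors
M. R. Murty, K. Sinha, *Effective equidistribution of eigenvalues of Hecke operators*, J. Number
Theory **129** (2009) 681–714 [MurtySinha2009], **Theorem 2** (p. 682) in weight `2` as the named
fact `murtySinha2009_thm2_weightTwo`. The printed proof of Theorem 2 (pp. 684–701) has three
ingredients: (1) Theorem 8 (p. 686), a variant of the Erdős–Turán inequality bounding the
`μ`-discrepancy `D_{I,V}(μ) = |N_I(V) - V μ(I)|` of points `x_1, …, x_V` against a measure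
`μ = F(-x) dx` by `V‖μ‖/(M+1) + Σ_{1 ≤ |m| ≤ M} (1/(M+1) + min(b-a, 1/π|m|)) |Σ_n e(m x_n) - V c_m|`,
proved in §§3–4 with the Beurling–Selberg extremal trigonometric polynomials (Vaaler); (2) the
Eichler–Selberg trace formula (Thm. 10) with the estimates of §§7–9 (Thm. 18: the Weyl limits `c_m`
of the angles `±θ_i`, `a_{p,i} = 2p^{(k-1)/2} cos θ_i`, and the error terms); (3) the bookkeeping of
§10 (`M = [c log kN / log p]`).

This file PROVES ingredient (1) in the following form (`abs_ceilCount_sub_integral_le`):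
for a continuous `2π`-periodic density `g` (`∫_{-π}^{π} g = 1`, `g ≤ G`), points `θ_j` (`j ∈ ι`,
`n = #ι`) and `M ≥ 0`, `ε ≥ 0` with
`|Σ_j cos(dθ_j) - n ∫_{-π}^{π} g cos(d·)| ≤ ε`, `|Σ_j sin(dθ_j) - n ∫_{-π}^{π} g sin(d·)| ≤ ε`
(`1 ≤ d ≤ M`), every arc count satisfies

  `|#{(j, k) ∈ ι × ℤ : u ≤ θ_j + 2πk < v} - n ∫_u^v g| ≤ 24π nG/(M+1) + 4(M+1)ε/π`.

**Deviation from print (method, not statement).** Mathlib has no Beurling–Selberg/Vaaler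
polynomials, so instead of sandwiching `χ_I` between extremal majorants/minorants (loc. cit. §3) we
smooth the discrepancy *function* `D(t) = Σ_j sawtooth(t - θ_j) - n Ψ(t)` (`Ψ(t) = ∫_0^t g - t/2π`)
with the Fejér kernel `F_M` (the tree's `Literature.Probability.LatticeModels.fejerKernel (M+1)`, of
which we use non-negativity and the decay `fejerKernel_le_div_sq`, adding the double-cosine-sum form,
the mass `∫_{-π}^{π} F_M = 2π` and the tail bound) — the classical proof of the Erdős–Turán inequality (Montgomery,
*Ten lectures on the interface between analytic number theory and harmonic analysis*, Ch. 1): `D` is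
`2π`-periodic and decreases at rate at most `nG` between its upward jumps, so a large value of
`D - mean` persists on a window of length `8π/(M+1)` to the right, where `F_M` puts `≥ 3/4` of its
mass (`fejerKernel_le_div_sq`, Jordan's inequality), whereas `∫ D(t) F_M(s-t) dt` is, up to the mean,
a combination of the `≤ (M+1)²` Fourier–Stieltjes coefficients `∫ D cos(d·)`, `∫ D sin(d·)`,
`1 ≤ d ≤ M`, each of size `≤ ε/d` (`integral_discrepancy_mul_cos/sin`: these are
`∓(1/d)(Σ_j sin/cos(dθ_j) - n ĝ(d))`, by the Fourier series of the sawtooth and an integration by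
parts). The same for the reflection `t ↦ -D(-t)` bounds `mean - D`, and the two bounds close up to
`sup D - inf D ≤ 24π nG/(M+1) + 4(M+1)ε/π` (`oscillation_le_of_fourier`). Only the constants differ
from Thm. 8; they are immaterial for Theorem 2 (whose implied constant is unspecified).

Everything here is real-variable harmonic analysis on `[−π, π]` (interval integrals; no measure on
the circle is introduced, arcs are counted through `⌈(v-θ)/2π⌉ - ⌈(u-θ)/2π⌉ = #{k : u ≤ θ+2πk < v}`);
the application to Hecke eigenvalues (Serre's measure `μ_p`, Murty–Sinha Thm. 18, the trace formula)
is in `Literature/NumberTheory/EllipticCurves/MurtySinhaKestenMcKay.lean` and its siblings.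
No Mathlib duplicate: Mathlib has neither the Erdős–Turán inequality nor discrepancy
(`lean search 'ErdosTuran|erdosTuran|discrepancy_le|BeurlingSelberg'`, 2026-08-15).

## References

* [MurtySinha2009] M. R. Murty, K. Sinha, J. Number Theory 129 (2009) 681–714: §2 (p. 685–686,
  Erdős–Turán, `D_{I,V}(μ)`), Thm. 8 (p. 686), §§3–4 (pp. 686–689). Held:
  `paper:doi-10-1016-j-jnt-2008-10-010` (PDF page = journal page − 680 + 1).
* H. L. Montgomery, *Ten lectures on the interface between analytic number theory and harmonic
  analysis*, CBMS 84, AMS 1994, Ch. 1 (Fejér kernel, Erdős–Turán inequality).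
-/

noncomputable section

open Real MeasureTheory intervalIntegral Finset
open Literature.Probability.LatticeModels (fejerKernel dirichletSum fejerKernel_nonneg
  fejerKernel_le_div_sq)

namespace Literature.Analysis.Fourier

/-! ### The Fejér kernel: double-sum form, mass and tails -/
/-- `|Σ_{k < L} e^{iku}|² = Σ_{k,l < L} cos((k-l)u)` for the tree's Dirichlet sum
`Literature.Probability.LatticeModels.dirichletSum` (expand `z z̄`; companion of
`Literature.Probability.LatticeModels.fejerKernel_eq_sum_cos`, which groups the terms by `k - l`).
[folklore] -/
theorem norm_dirichletSum_sq_eq_double_sum (L : ℕ) (u : ℝ) :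
    ‖dirichletSum L u‖ ^ 2 =
      ∑ k ∈ range L, ∑ l ∈ range L, Real.cos (((k : ℝ) - l) * u) := by
  set z : ℂ := dirichletSum L u with hz
  have h1 : ((‖z‖ ^ 2 : ℝ) : ℂ) = (starRingEnd ℂ) z * z := by
    rw [← Complex.normSq_eq_norm_sq, Complex.normSq_eq_conj_mul_self]
  have h2 : (starRingEnd ℂ) z * z =
      ∑ k ∈ range L, ∑ l ∈ range L,
        Complex.exp (((((k : ℝ) - l) * u : ℝ) : ℂ) * Complex.I) := by
    rw [hz, dirichletSum, map_sum, Finset.sum_mul_sum, Finset.sum_comm]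
    refine Finset.sum_congr rfl fun k _ => Finset.sum_congr rfl fun l _ => ?_
    rw [← Complex.exp_conj, ← Complex.exp_add]
    congr 1
    simp only [map_mul, Complex.conj_I, Complex.conj_ofReal]
    push_cast
    ring
  have h3 := congrArg Complex.re (h1.trans h2)
  rw [Complex.ofReal_re] at h3
  rw [h3, Complex.re_sum]
  refine Finset.sum_congr rfl fun k _ => ?_
  rw [Complex.re_sum]
  refine Finset.sum_congr rfl fun l _ => ?_
  exact Complex.exp_ofReal_mul_I_re _

/-- The tree's Fejér kernel `Literature.Probability.LatticeModels.fejerKernel (M+1) u = |Σ_{k ≤ M}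
e^{iku}|²/(M+1)` as the double cosine sum `Σ_{k,l ≤ M} cos((k-l)u)/(M+1)`. [folklore] -/
theorem fejerKernel_eq_double_sum_cos (M : ℕ) (u : ℝ) :
    fejerKernel (M + 1) u =
      (∑ k ∈ range (M + 1), ∑ l ∈ range (M + 1), Real.cos (((k : ℝ) - l) * u)) / (M + 1) := by
  rw [fejerKernel, norm_dirichletSum_sq_eq_double_sum]
  push_cast
  rfl

/-- `F_M` is continuous. [folklore] -/
theorem continuous_fejerKernel (M : ℕ) : Continuous (fejerKernel (M + 1)) := by
  have : fejerKernel (M + 1) = fun u => (∑ k ∈ range (M + 1), ∑ l ∈ range (M + 1),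
      Real.cos (((k : ℝ) - l) * u)) / (M + 1) := funext (fejerKernel_eq_double_sum_cos M)
  rw [this]
  fun_prop

/-- `F_M` is even. [folklore] -/
theorem fejerKernel_neg (M : ℕ) (u : ℝ) : fejerKernel (M + 1) (-u) = fejerKernel (M + 1) u := by
  simp only [fejerKernel_eq_double_sum_cos, mul_neg, Real.cos_neg]

/-- `F_M` has period `2π`. [folklore] -/
theorem fejerKernel_add_two_pi (M : ℕ) (u : ℝ) : fejerKernel (M + 1) (u + 2 * π) = fejerKernel (M + 1) u := by
  simp only [fejerKernel_eq_double_sum_cos]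
  congr 1
  refine Finset.sum_congr rfl fun k _ => Finset.sum_congr rfl fun l _ => ?_
  have : ((k : ℝ) - l) * (u + 2 * π) = ((k : ℝ) - l) * u + ((k : ℤ) - l : ℤ) * (2 * π) := by
    push_cast; ring
  rw [this, Real.cos_add_int_mul_two_pi]

/-- `F_M` has period `2π`. [folklore] -/
theorem fejerKernel_periodic (M : ℕ) : Function.Periodic (fejerKernel (M + 1)) (2 * π) := fejerKernel_add_two_pi M

/-- `∫_{-π}^{π} cos(cu) du = 0` for a non-zero integer `c`. [folklore] -/
theorem integral_cos_int_mul {c : ℤ} (hc : c ≠ 0) : ∫ u in (-π)..π, Real.cos (c * u) = 0 := by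
  have hc' : (c : ℝ) ≠ 0 := Int.cast_ne_zero.mpr hc
  rw [intervalIntegral.integral_comp_mul_left (fun x => Real.cos x) hc', integral_cos]
  have h1 : Real.sin (c * π) = 0 := Real.sin_int_mul_pi c
  have h2 : Real.sin (c * -π) = 0 := by rw [mul_neg, Real.sin_neg, h1, neg_zero]
  simp [h1]

/-- `∫_{-π}^{π} cos((k-l)u) du = 2π δ_{kl}`. [folklore] -/
theorem integral_cos_sub_mul (k l : ℕ) :
    ∫ u in (-π)..π, Real.cos (((k : ℝ) - l) * u) = if k = l then 2 * π else 0 := by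
  split_ifs with h
  · subst h
    simp
    ring
  · have hc : ((k : ℤ) - l : ℤ) ≠ 0 := by omega
    have := integral_cos_int_mul hc
    push_cast at this
    exact this

/-- `∫_{-π}^{π} F_M = 2π` (unit mass after normalising by `2π`). [folklore] -/
theorem integral_fejerKernel (M : ℕ) : ∫ u in (-π)..π, fejerKernel (M + 1) u = 2 * π := by
  have hM : (0 : ℝ) < M + 1 := by positivity
  have hcont : ∀ k l : ℕ,
      IntervalIntegrable (fun u : ℝ => Real.cos (((k : ℝ) - l) * u)) volume (-π) π := fun k l =>
    (by fun_prop : Continuous fun u : ℝ => Real.cos (((k : ℝ) - l) * u)).intervalIntegrable _ _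
  have hrow : ∀ k ∈ range (M + 1),
      ∫ u in (-π)..π, ∑ l ∈ range (M + 1), Real.cos (((k : ℝ) - l) * u) = 2 * π := by
    intro k hk
    rw [intervalIntegral.integral_finsetSum fun l _ => hcont k l]
    simp_rw [integral_cos_sub_mul]
    rw [Finset.sum_ite_eq, if_pos hk]
  simp only [fejerKernel_eq_double_sum_cos]
  rw [intervalIntegral.integral_div, intervalIntegral.integral_finsetSum fun k _ => ?_]
  · rw [Finset.sum_congr rfl hrow]
    simp
    field_simp
  · exact (by fun_prop : Continuous fun u : ℝ =>
      ∑ l ∈ range (M + 1), Real.cos (((k : ℝ) - l) * u)).intervalIntegrable _ _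

/-- Tail estimate `∫_δ^π F_M ≤ π²/((M+1)δ)`. [folklore] -/
theorem integral_fejerKernel_tail_le (M : ℕ) {δ : ℝ} (hδ : 0 < δ) (hδπ : δ ≤ π) :
    ∫ u in δ..π, fejerKernel (M + 1) u ≤ π ^ 2 / ((M + 1) * δ) := by
  have hM : (0 : ℝ) < M + 1 := by positivity
  have hmono : ∫ u in δ..π, fejerKernel (M + 1) u ≤ ∫ u in δ..π, π ^ 2 / (M + 1) * (u ^ 2)⁻¹ := by
    refine intervalIntegral.integral_mono_on hδπ ((continuous_fejerKernel M).intervalIntegrable _ _) ?_ ?_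
    · refine ContinuousOn.intervalIntegrable ?_
      refine ContinuousOn.mul continuousOn_const ?_
      refine ContinuousOn.inv₀ (by fun_prop) ?_
      intro x hx
      rw [Set.uIcc_of_le hδπ] at hx
      have : 0 < x := lt_of_lt_of_le hδ hx.1
      positivity
    · intro u hu
      have hu0 : 0 < u := lt_of_lt_of_le hδ hu.1
      have := fejerKernel_le_div_sq (L := M + 1) (by omega) hu0.ne'
        (by rw [abs_of_pos hu0]; exact hu.2)
      push_cast at this
      calc fejerKernel (M + 1) u ≤ π ^ 2 / ((M + 1) * u ^ 2) := this
        _ = π ^ 2 / (M + 1) * (u ^ 2)⁻¹ := by field_simp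
  refine hmono.trans ?_
  rw [intervalIntegral.integral_const_mul]
  have hint : ∫ u in δ..π, (u ^ 2)⁻¹ = -π⁻¹ - -δ⁻¹ := by
    have key : ∀ x ∈ Set.uIcc δ π, HasDerivAt (fun u : ℝ => -u⁻¹) ((x ^ 2)⁻¹) x := by
      intro x hx
      rw [Set.uIcc_of_le hδπ] at hx
      have hx0 : x ≠ 0 := (lt_of_lt_of_le hδ hx.1).ne'
      have h := (hasDerivAt_inv hx0).neg
      rw [neg_neg] at h
      exact h
    have hii : IntervalIntegrable (fun u : ℝ => (u ^ 2)⁻¹) volume δ π := by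
      refine ContinuousOn.intervalIntegrable ?_
      refine ContinuousOn.inv₀ (by fun_prop) ?_
      intro x hx
      rw [Set.uIcc_of_le hδπ] at hx
      have : 0 < x := lt_of_lt_of_le hδ hx.1
      positivity
    exact intervalIntegral.integral_eq_sub_of_hasDerivAt key hii
  rw [hint]
  have hπ := Real.pi_pos
  rw [div_mul_eq_mul_div, div_le_div_iff₀ hM (by positivity)]
  have : -π⁻¹ - -δ⁻¹ ≤ δ⁻¹ := by
    have : 0 < π⁻¹ := by positivity
    linarith
  calc π ^ 2 * (-π⁻¹ - -δ⁻¹) * ((M + 1) * δ) ≤ π ^ 2 * δ⁻¹ * ((M + 1) * δ) := by gcongr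
    _ = π ^ 2 * (M + 1) := by field_simp

/-- Tail estimate `∫_{-π}^{-δ} F_M ≤ π²/((M+1)δ)`. [folklore] -/
theorem integral_fejerKernel_tail_le' (M : ℕ) {δ : ℝ} (hδ : 0 < δ) (hδπ : δ ≤ π) :
    ∫ u in (-π)..(-δ), fejerKernel (M + 1) u ≤ π ^ 2 / ((M + 1) * δ) := by
  have h1 : ∫ u in (-π)..(-δ), fejerKernel (M + 1) u = ∫ u in (-π)..(-δ), fejerKernel (M + 1) (-u) := by
    simp_rw [fejerKernel_neg]
  rw [h1, intervalIntegral.integral_comp_neg, neg_neg, neg_neg]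
  exact integral_fejerKernel_tail_le M hδ hδπ


/-! ### One-sided Lipschitz periodic functions -/

section Smoothing

variable {Δ : ℝ → ℝ} {K : ℝ}

/-- A `2π`-periodic function which decreases at rate at most `K` (`Δ(t') ≥ Δ(t) - K(t'-t)` for `t ≤
t'`, upward jumps allowed) oscillates by at most `2πK`. [folklore] -/
theorem sub_le_two_pi_mul_of_oneSided (hK : 0 ≤ K) (hper : Function.Periodic Δ (2 * π))
    (hlip : ∀ t t', t ≤ t' → Δ t - K * (t' - t) ≤ Δ t') (t t' : ℝ) :
    Δ t - Δ t' ≤ 2 * π * K := by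
  have h2π : (0 : ℝ) < 2 * π := by positivity
  set t'' := toIcoMod h2π t t' with ht''
  have hmem : t'' ∈ Set.Ico t (t + 2 * π) := toIcoMod_mem_Ico h2π t t'
  have heq : Δ t'' = Δ t' := by
    rw [ht'', toIcoMod]
    exact hper.sub_zsmul_eq _
  have h := hlip t t'' hmem.1
  have h2 : K * (t'' - t) ≤ K * (2 * π) :=
    mul_le_mul_of_nonneg_left (by linarith [hmem.2]) hK
  linarith

/-- Such a function is bounded: `|Δ(t)| ≤ |Δ(0)| + 2πK`. [folklore] -/
theorem abs_le_of_oneSided (hK : 0 ≤ K) (hper : Function.Periodic Δ (2 * π))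
    (hlip : ∀ t t', t ≤ t' → Δ t - K * (t' - t) ≤ Δ t') (t : ℝ) :
    |Δ t| ≤ |Δ 0| + 2 * π * K := by
  have h1 := sub_le_two_pi_mul_of_oneSided hK hper hlip t 0
  have h2 := sub_le_two_pi_mul_of_oneSided hK hper hlip 0 t
  rw [abs_le]
  constructor <;> cases abs_le.mp (le_refl |Δ 0|) <;> linarith

/-- Such a function, if measurable, is integrable on every interval. [folklore] -/
theorem intervalIntegrable_of_oneSided (hK : 0 ≤ K) (hper : Function.Periodic Δ (2 * π))
    (hmeas : Measurable Δ) (hlip : ∀ t t', t ≤ t' → Δ t - K * (t' - t) ≤ Δ t') (a b : ℝ) :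
    IntervalIntegrable Δ volume a b := by
  rw [intervalIntegrable_iff]
  refine Measure.integrableOn_of_bounded (M := |Δ 0| + 2 * π * K) ?_
    hmeas.aestronglyMeasurable ?_
  · rw [Real.volume_uIoc]
    exact ENNReal.ofReal_ne_top
  · exact Filter.Eventually.of_forall fun t => by
      rw [Real.norm_eq_abs]; exact abs_le_of_oneSided hK hper hlip t

end Smoothing

/-! ### The Fourier side of the smoothing argument -/

section Fourier

variable {Δ : ℝ → ℝ}

/-- `Δ(t) cos(ct)` is `2π`-periodic for integer `c`. [folklore] -/
theorem periodic_mul_cos (hper : Function.Periodic Δ (2 * π)) (c : ℤ) :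
    Function.Periodic (fun t => Δ t * Real.cos (c * t)) (2 * π) := by
  intro t
  simp only
  rw [hper t, mul_add, Real.cos_add_int_mul_two_pi]

/-- `Δ(t) sin(ct)` is `2π`-periodic for integer `c`. [folklore] -/
theorem periodic_mul_sin (hper : Function.Periodic Δ (2 * π)) (c : ℤ) :
    Function.Periodic (fun t => Δ t * Real.sin (c * t)) (2 * π) := by
  intro t
  simp only
  rw [hper t, mul_add, Real.sin_add_int_mul_two_pi]

/-- `∫_{s-π}^{s+π} f = ∫_{-π}^{π} f` for `2π`-periodic `f`. [folklore] -/
theorem integral_periodic_shift {f : ℝ → ℝ} (hf : Function.Periodic f (2 * π)) (s : ℝ) :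
    ∫ t in (s - π)..(s + π), f t = ∫ t in (-π)..π, f t := by
  have h1 : s + π = (s - π) + 2 * π := by ring
  rw [h1, hf.intervalIntegral_add_eq (s - π) (-π)]
  congr 1
  ring

/-- One off-diagonal term of the smoothed function: for `k ≠ l` in `[0, M]`, `|∫_{s-π}^{s+π} Δ(t)
cos((k-l)(s-t)) dt| ≤ 2ε` when the Fourier–Stieltjes data `|∫Δ cos(d·)|, |∫Δ sin(d·)| ≤ ε` (`1 ≤ d
≤ M`). [folklore] -/
theorem abs_integral_mul_cos_sub_le {ε : ℝ} {M : ℕ} (hper : Function.Periodic Δ (2 * π))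
    (hint : ∀ a b, IntervalIntegrable Δ volume a b)
    (hF : ∀ d : ℕ, 1 ≤ d → d ≤ M →
      |∫ t in (-π)..π, Δ t * Real.cos (d * t)| ≤ ε ∧ |∫ t in (-π)..π, Δ t * Real.sin (d * t)| ≤ ε)
    (s : ℝ) {k l : ℕ} (hk : k ≤ M) (hl : l ≤ M) (hkl : k ≠ l) :
    |∫ t in (s - π)..(s + π), Δ t * Real.cos (((k : ℝ) - l) * (s - t))| ≤ 2 * ε := by
  -- reduce to `d = |k - l|`
  obtain ⟨d, σ, hd1, hdM, hσ, hc⟩ : ∃ d : ℕ, ∃ σ : ℝ, 1 ≤ d ∧ d ≤ M ∧ (σ = 1 ∨ σ = -1) ∧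
      ((k : ℝ) - l) = σ * d := by
    rcases lt_or_gt_of_ne hkl with h | h
    · refine ⟨l - k, -1, by omega, by omega, Or.inr rfl, ?_⟩
      rw [Nat.cast_sub h.le]; ring
    · refine ⟨k - l, 1, by omega, by omega, Or.inl rfl, ?_⟩
      rw [Nat.cast_sub h.le]; ring
  obtain ⟨hC, hS⟩ := hF d hd1 hdM
  have key : ∀ t, Δ t * Real.cos (((k : ℝ) - l) * (s - t)) =
      Real.cos (d * s) * (Δ t * Real.cos (d * t)) + Real.sin (d * s) * (Δ t * Real.sin (d * t)) := by
    intro t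
    rw [hc]
    rcases hσ with rfl | rfl
    · rw [show (1 : ℝ) * d * (s - t) = d * s - d * t by ring, Real.cos_sub]; ring
    · rw [show (-1 : ℝ) * d * (s - t) = d * t - d * s by ring, Real.cos_sub]; ring
  simp_rw [key]
  have hi1 : IntervalIntegrable (fun t => Real.cos (d * s) * (Δ t * Real.cos (d * t))) volume
      (s - π) (s + π) := ((hint _ _).mul_continuousOn (by fun_prop)).const_mul _
  have hi2 : IntervalIntegrable (fun t => Real.sin (d * s) * (Δ t * Real.sin (d * t))) volume
      (s - π) (s + π) := ((hint _ _).mul_continuousOn (by fun_prop)).const_mul _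
  have hpc := integral_periodic_shift (periodic_mul_cos hper d) s
  have hps := integral_periodic_shift (periodic_mul_sin hper d) s
  push_cast at hpc hps
  rw [intervalIntegral.integral_add hi1 hi2, intervalIntegral.integral_const_mul,
    intervalIntegral.integral_const_mul, hpc, hps]
  have h1 : |Real.cos (d * s) * ∫ t in (-π)..π, Δ t * Real.cos (d * t)| ≤ ε := by
    rw [abs_mul]
    calc _ ≤ 1 * ε := mul_le_mul (Real.abs_cos_le_one _) hC (abs_nonneg _) zero_le_one
      _ = ε := one_mul ε
  have h2 : |Real.sin (d * s) * ∫ t in (-π)..π, Δ t * Real.sin (d * t)| ≤ ε := by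
    rw [abs_mul]
    calc _ ≤ 1 * ε := mul_le_mul (Real.abs_sin_le_one _) hS (abs_nonneg _) zero_le_one
      _ = ε := one_mul ε
  calc _ ≤ _ := abs_add_le _ _
    _ ≤ ε + ε := add_le_add h1 h2
    _ = 2 * ε := by ring

/-- **Fourier side of the smoothing argument**: `∫_{s-π}^{s+π} Δ(t) F_M(s-t) dt ≤ ∫_{-π}^{π} Δ +
2(M+1)ε` (the diagonal `k = l` of the double cosine sum gives the mean, each of the `≤ (M+1)²`
off-diagonal terms is `≤ 2ε`). This replaces the evaluation of `Σ Ŝ^±_M(m) c_m` in Murty–Sinha §4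
(p. 689). [cite: MurtySinha2009, §4 p. 689 (proof of Thm. 8)] -/
theorem integral_mul_fejerKernel_le {ε : ℝ} {M : ℕ} (hper : Function.Periodic Δ (2 * π))
    (hint : ∀ a b, IntervalIntegrable Δ volume a b)
    (hF : ∀ d : ℕ, 1 ≤ d → d ≤ M →
      |∫ t in (-π)..π, Δ t * Real.cos (d * t)| ≤ ε ∧ |∫ t in (-π)..π, Δ t * Real.sin (d * t)| ≤ ε)
    (hε : 0 ≤ ε) (s : ℝ) :
    ∫ t in (s - π)..(s + π), Δ t * fejerKernel (M + 1) (s - t) ≤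
      (∫ t in (-π)..π, Δ t) + 2 * (M + 1) * ε := by
  have hM : (0 : ℝ) < M + 1 := by positivity
  -- expand the kernel
  have hexp : ∀ t, Δ t * fejerKernel (M + 1) (s - t) =
      (∑ k ∈ range (M + 1), Δ t * ∑ l ∈ range (M + 1),
        Real.cos (((k : ℝ) - l) * (s - t))) / (M + 1) := by
    intro t
    rw [fejerKernel_eq_double_sum_cos, mul_div_assoc', Finset.mul_sum]
  simp_rw [hexp]
  rw [intervalIntegral.integral_div, div_le_iff₀ hM]
  have hi : ∀ k l : ℕ, IntervalIntegrable (fun t => Δ t * Real.cos (((k : ℝ) - l) * (s - t)))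
      volume (s - π) (s + π) := fun k l => (hint _ _).mul_continuousOn (by fun_prop)
  have hik : ∀ k : ℕ, IntervalIntegrable (fun t => Δ t * ∑ l ∈ range (M + 1),
      Real.cos (((k : ℝ) - l) * (s - t))) volume (s - π) (s + π) :=
    fun k => (hint _ _).mul_continuousOn (by fun_prop)
  rw [intervalIntegral.integral_finsetSum fun k _ => hik k]
  -- the term `a k l`
  set a : ℕ → ℕ → ℝ := fun k l => ∫ t in (s - π)..(s + π),
    Δ t * Real.cos (((k : ℝ) - l) * (s - t)) with ha
  have hrow : ∀ k ∈ range (M + 1), ∫ t in (s - π)..(s + π), Δ t * ∑ l ∈ range (M + 1),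
      Real.cos (((k : ℝ) - l) * (s - t)) = ∑ l ∈ range (M + 1), a k l := by
    intro k _
    simp_rw [Finset.mul_sum]
    rw [intervalIntegral.integral_finsetSum fun l _ => hi k l]
  rw [Finset.sum_congr rfl hrow]
  -- diagonal terms
  have hdiag : ∀ k, a k k = ∫ t in (-π)..π, Δ t := by
    intro k
    simp only [ha, sub_self, zero_mul, Real.cos_zero, mul_one]
    exact integral_periodic_shift hper s
  -- off-diagonal terms
  have hoff : ∀ k ∈ range (M + 1), ∀ l ∈ (range (M + 1)).erase k, a k l ≤ 2 * ε := by
    intro k hk l hl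
    rw [Finset.mem_erase] at hl
    have hkM : k ≤ M := Nat.lt_succ_iff.mp (Finset.mem_range.mp hk)
    have hlM : l ≤ M := Nat.lt_succ_iff.mp (Finset.mem_range.mp hl.2)
    exact (le_abs_self _).trans
      (abs_integral_mul_cos_sub_le hper hint hF s hkM hlM (Ne.symm hl.1))
  have hrowle : ∀ k ∈ range (M + 1), ∑ l ∈ range (M + 1), a k l ≤
      (∫ t in (-π)..π, Δ t) + 2 * (M + 1) * ε := by
    intro k hk
    rw [← Finset.add_sum_erase _ _ hk, hdiag k]
    gcongr
    calc ∑ l ∈ (range (M + 1)).erase k, a k l ≤ ∑ l ∈ (range (M + 1)).erase k, 2 * ε :=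
          Finset.sum_le_sum (hoff k hk)
      _ = M * (2 * ε) := by
          rw [Finset.sum_const, Finset.card_erase_of_mem hk, Finset.card_range, nsmul_eq_mul]
          push_cast
          ring
      _ ≤ (M + 1) * (2 * ε) := by nlinarith
      _ = 2 * (M + 1) * ε := by ring
  calc ∑ k ∈ range (M + 1), ∑ l ∈ range (M + 1), a k l
      ≤ ∑ k ∈ range (M + 1), ((∫ t in (-π)..π, Δ t) + 2 * (M + 1) * ε) :=
        Finset.sum_le_sum hrowle
    _ = ((∫ t in (-π)..π, Δ t) + 2 * (M + 1) * ε) * (M + 1) := by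
        rw [Finset.sum_const, Finset.card_range, nsmul_eq_mul]
        push_cast
        ring

end Fourier

/-! ### The window argument -/

section Window

variable {Δ : ℝ → ℝ} {K : ℝ}

/-- **Window bound** (the space side of the smoothing argument, `M ≥ 3`): if moreover `m ≤ Δ`
everywhere, then for every `t₁`, `Δ(t₁) - c̄ ≤ 8πK/(M+1) + (c̄ - m)/3 + 4(M+1)ε/(3π)`, `c̄ =
(2π)⁻¹∫_{-π}^{π} Δ` the mean: on the window `[t₁, t₁ + 8π/(M+1)]` one has `Δ ≥ Δ(t₁) - 8πK/(M+1)`,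
and the Fejér kernel centred at the window puts mass `≥ 3π/2` (out of `2π`) there
(`integral_fejerKernel_tail_le`), while `Δ - m ≥ 0` off the window; compare with
`integral_mul_fejerKernel_le`. [folklore] -/
theorem window_bound {ε m : ℝ} {M : ℕ} (hM : 3 ≤ M) (hK : 0 ≤ K)
    (hper : Function.Periodic Δ (2 * π)) (hmeas : Measurable Δ)
    (hlip : ∀ t t', t ≤ t' → Δ t - K * (t' - t) ≤ Δ t')
    (hm : ∀ t, m ≤ Δ t)
    (hF : ∀ d : ℕ, 1 ≤ d → d ≤ M →
      |∫ t in (-π)..π, Δ t * Real.cos (d * t)| ≤ ε ∧ |∫ t in (-π)..π, Δ t * Real.sin (d * t)| ≤ ε)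
    (hε : 0 ≤ ε) (t₁ : ℝ) :
    Δ t₁ - (∫ t in (-π)..π, Δ t) / (2 * π) ≤
      K * (8 * π / (M + 1)) + ((∫ t in (-π)..π, Δ t) / (2 * π) - m) / 3 +
        4 * (M + 1) * ε / (3 * π) := by
  have hint := intervalIntegrable_of_oneSided hK hper hmeas hlip
  have hπ := Real.pi_pos
  set C₀ := ∫ t in (-π)..π, Δ t with hC₀
  set L : ℝ := 8 * π / (M + 1) with hL
  have hM1 : (4 : ℝ) ≤ M + 1 := by exact_mod_cast (show 4 ≤ M + 1 by omega)
  have hM0 : (0 : ℝ) < M + 1 := by positivity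
  have hL0 : 0 < L := by positivity
  have hL2 : L / 2 = 4 * π / (M + 1) := by rw [hL]; ring
  have hLπ : L / 2 ≤ π := by
    rw [hL2, div_le_iff₀ hM0]
    nlinarith
  set s := t₁ + L / 2 with hs
  -- the mean dominates the lower bound
  have hmC : 2 * π * m ≤ C₀ := by
    have h := intervalIntegral.integral_mono_on (by linarith : -π ≤ π)
      intervalIntegrable_const (hint _ _) (fun t _ => hm t) (f := fun _ => m)
    simp only [intervalIntegral.integral_const, smul_eq_mul] at h
    linarith
  set c : ℝ := C₀ / (2 * π) with hc
  have hC₀c : C₀ = 2 * π * c := by rw [hc]; field_simp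
  have hmc : m ≤ c := by
    rw [hc, le_div_iff₀ (by positivity)]
    linarith
  -- the Fourier side
  have hI := integral_mul_fejerKernel_le hper hint hF hε s
  -- the trivial case
  set β := Δ t₁ - K * L - m with hβ
  by_cases hβ0 : β ≤ 0
  · have h1 : 0 ≤ (c - m) / 3 := by linarith
    have h2 : 0 ≤ 4 * (M + 1) * ε / (3 * π) := by positivity
    show Δ t₁ - c ≤ K * L + (c - m) / 3 + 4 * (M + 1) * ε / (3 * π)
    linarith
  replace hβ0 : 0 < β := not_le.mp hβ0
  -- (w1) mass of the kernel in the window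
  have hW : 3 * π / 2 ≤ ∫ t in t₁..(t₁ + L), fejerKernel (M + 1) (s - t) := by
    rw [intervalIntegral.integral_comp_sub_left (fejerKernel (M + 1)) s]
    have e1 : s - (t₁ + L) = -(L / 2) := by rw [hs]; ring
    have e2 : s - t₁ = L / 2 := by rw [hs]; ring
    rw [e1, e2]
    have hfi : ∀ a b, IntervalIntegrable (fejerKernel (M + 1)) volume a b := fun a b =>
      (continuous_fejerKernel M).intervalIntegrable a b
    have hsplit1 : (∫ v in (-π)..(-(L / 2)), fejerKernel (M + 1) v) + ∫ v in (-(L / 2))..π, fejerKernel (M + 1) v =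
        2 * π := by
      rw [intervalIntegral.integral_add_adjacent_intervals (hfi _ _) (hfi _ _), integral_fejerKernel]
    have hsplit2 : (∫ v in (-(L / 2))..(L / 2), fejerKernel (M + 1) v) + ∫ v in (L / 2)..π, fejerKernel (M + 1) v =
        ∫ v in (-(L / 2))..π, fejerKernel (M + 1) v :=
      intervalIntegral.integral_add_adjacent_intervals (hfi _ _) (hfi _ _)
    have hT1 := integral_fejerKernel_tail_le' M (half_pos hL0) hLπ
    have hT2 := integral_fejerKernel_tail_le M (half_pos hL0) hLπ
    have hq : π ^ 2 / ((M + 1) * (L / 2)) = π / 4 := by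
      rw [hL2]
      field_simp
    rw [hq] at hT1 hT2
    linarith
  -- (w2) pointwise lower bound in the window
  have hwin : ∀ t ∈ Set.Icc t₁ (t₁ + L), β ≤ Δ t - m := by
    intro t ht
    have h := hlip t₁ t ht.1
    have h2 : K * (t - t₁) ≤ K * L := mul_le_mul_of_nonneg_left (by linarith [ht.2]) hK
    rw [hβ]
    linarith
  -- (w3) + (w4) + (w5)
  have hcontF : Continuous fun t => fejerKernel (M + 1) (s - t) :=
    (continuous_fejerKernel M).comp (continuous_const.sub continuous_id)
  have hfi2 : ∀ a b, IntervalIntegrable (fun t => fejerKernel (M + 1) (s - t)) volume a b := fun a b =>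
    hcontF.intervalIntegrable a b
  have hprod : ∀ a b, IntervalIntegrable (fun t => (Δ t - m) * fejerKernel (M + 1) (s - t)) volume a b :=
    fun a b => ((hint a b).sub intervalIntegrable_const).mul_continuousOn hcontF.continuousOn
  have hΔF : ∀ a b, IntervalIntegrable (fun t => Δ t * fejerKernel (M + 1) (s - t)) volume a b :=
    fun a b => (hint a b).mul_continuousOn hcontF.continuousOn
  have hmF : ∀ a b, IntervalIntegrable (fun t => m * fejerKernel (M + 1) (s - t)) volume a b :=
    fun a b => (hfi2 a b).const_mul m
  have h3 : ∫ t in t₁..(t₁ + L), β * fejerKernel (M + 1) (s - t) ≤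
      ∫ t in t₁..(t₁ + L), (Δ t - m) * fejerKernel (M + 1) (s - t) := by
    refine intervalIntegral.integral_mono_on (by linarith) ((hfi2 _ _).const_mul β) (hprod _ _)
      fun t ht => ?_
    exact mul_le_mul_of_nonneg_right (hwin t ht) (fejerKernel_nonneg (M + 1) _)
  have h4 : ∫ t in t₁..(t₁ + L), (Δ t - m) * fejerKernel (M + 1) (s - t) ≤
      ∫ t in (s - π)..(s + π), (Δ t - m) * fejerKernel (M + 1) (s - t) := by
    refine intervalIntegral.integral_mono_interval (by linarith) (by linarith) (by linarith)
      ?_ (hprod _ _)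
    exact Filter.Eventually.of_forall fun t =>
      mul_nonneg (by linarith [hm t]) (fejerKernel_nonneg (M + 1) _)
  have h5 : ∫ t in (s - π)..(s + π), (Δ t - m) * fejerKernel (M + 1) (s - t) =
      (∫ t in (s - π)..(s + π), Δ t * fejerKernel (M + 1) (s - t)) - 2 * π * m := by
    have e : ∀ t, (Δ t - m) * fejerKernel (M + 1) (s - t) = Δ t * fejerKernel (M + 1) (s - t) - m * fejerKernel (M + 1) (s - t) :=
      fun t => by ring
    simp_rw [e]
    rw [intervalIntegral.integral_sub (hΔF _ _) (hmF _ _), intervalIntegral.integral_const_mul,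
      intervalIntegral.integral_comp_sub_left (fejerKernel (M + 1)) s]
    have e1 : s - (s + π) = -π := by ring
    have e2 : s - (s - π) = π := by ring
    rw [e1, e2, integral_fejerKernel]
    ring
  have hkey : 3 * π / 2 * β ≤ C₀ + 2 * (M + 1) * ε - 2 * π * m := by
    calc 3 * π / 2 * β ≤ (∫ t in t₁..(t₁ + L), fejerKernel (M + 1) (s - t)) * β :=
          mul_le_mul_of_nonneg_right hW hβ0.le
      _ = ∫ t in t₁..(t₁ + L), β * fejerKernel (M + 1) (s - t) := by
          rw [intervalIntegral.integral_const_mul, mul_comm]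
      _ ≤ _ := h3.trans h4
      _ = _ := h5
      _ ≤ _ := by linarith
  -- conclusion
  show Δ t₁ - c ≤ K * L + (c - m) / 3 + 4 * (M + 1) * ε / (3 * π)
  rw [hC₀c] at hkey
  have hβ' : β ≤ 4 / 3 * (c - m) + 4 * (M + 1) * ε / (3 * π) := by
    rw [← sub_nonneg] at hkey ⊢
    have : 4 / 3 * (c - m) + 4 * (M + 1) * ε / (3 * π) - β =
        (2 * π * c + 2 * (M + 1) * ε - 2 * π * m - 3 * π / 2 * β) * (2 / (3 * π)) := by
      field_simp
      ring
    rw [this]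
    exact mul_nonneg hkey (by positivity)
  rw [hβ] at hβ'
  linarith

/-- **The smoothing inequality (Erdős–Turán type, oscillation form).** Let `Δ : ℝ → ℝ` be
measurable, `2π`-periodic, with `Δ(t') ≥ Δ(t) - K(t' - t)` for `t ≤ t'` (`K ≥ 0`), and suppose
`|∫_{-π}^{π} Δ(t)cos(dt) dt| ≤ ε`, `|∫_{-π}^{π} Δ(t) sin(dt) dt| ≤ ε` for `1 ≤ d ≤ M` (`ε ≥ 0`).
Then `Δ(t) - Δ(t') ≤ 24πK/(M+1) + 4(M+1)ε/π` for all `t, t'`. (The window bound for `Δ` and for its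
reflection `t ↦ -Δ(-t)` give `sup Δ - c̄ ≤ W + (c̄ - inf Δ)/3` and `c̄ - inf Δ ≤ W + (sup Δ -
c̄)/3`, whence `sup Δ - inf Δ ≤ 3W`.) Applied to the `μ`-discrepancy function this is a form of
Murty–Sinha's Thm. 8 (p. 686, a variant of the Erdős–Turán inequality), proved here with the Fejér
kernel instead of the Beurling–Selberg polynomials, at the cost of the constants. [cite:
MurtySinha2009, Thm. 8 p. 686 (variant; Fejér-kernel proof)] -/
theorem oscillation_le_of_fourier {ε : ℝ} {M : ℕ} (hK : 0 ≤ K)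
    (hper : Function.Periodic Δ (2 * π)) (hmeas : Measurable Δ)
    (hlip : ∀ t t', t ≤ t' → Δ t - K * (t' - t) ≤ Δ t')
    (hF : ∀ d : ℕ, 1 ≤ d → d ≤ M →
      |∫ t in (-π)..π, Δ t * Real.cos (d * t)| ≤ ε ∧ |∫ t in (-π)..π, Δ t * Real.sin (d * t)| ≤ ε)
    (hε : 0 ≤ ε) (t t' : ℝ) :
    Δ t - Δ t' ≤ 24 * π * K / (M + 1) + 4 * (M + 1) * ε / π := by
  have hπ := Real.pi_pos
  have hM0 : (0 : ℝ) < M + 1 := by positivity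
  by_cases hM : M < 3
  · -- few harmonics: the trivial oscillation bound suffices
    have h1 := sub_le_two_pi_mul_of_oneSided hK hper hlip t t'
    have hM3 : (M : ℝ) + 1 ≤ 3 := by exact_mod_cast (show M + 1 ≤ 3 by omega)
    have h2 : 2 * π * K ≤ 24 * π * K / (M + 1) := by
      rw [le_div_iff₀ hM0]
      nlinarith [mul_nonneg (mul_nonneg (by norm_num : (0:ℝ) ≤ 2) hπ.le) hK]
    have h3 : 0 ≤ 4 * (M + 1) * ε / π := by positivity
    linarith
  replace hM : 3 ≤ M := not_lt.mp hM
  -- extrema of `Δ`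
  have hbdd := abs_le_of_oneSided hK hper hlip
  have habove : BddAbove (Set.range Δ) :=
    ⟨|Δ 0| + 2 * π * K, by rintro _ ⟨x, rfl⟩; exact (abs_le.mp (hbdd x)).2⟩
  have hbelow : BddBelow (Set.range Δ) :=
    ⟨-(|Δ 0| + 2 * π * K), by rintro _ ⟨x, rfl⟩; exact (abs_le.mp (hbdd x)).1⟩
  set mlo := sInf (Set.range Δ) with hmlo
  set mhi := sSup (Set.range Δ) with hmhi
  have hlo : ∀ x, mlo ≤ Δ x := fun x => csInf_le hbelow ⟨x, rfl⟩
  have hhi : ∀ x, Δ x ≤ mhi := fun x => le_csSup habove ⟨x, rfl⟩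
  have hne : (Set.range Δ).Nonempty := Set.range_nonempty Δ
  set C₀ := ∫ x in (-π)..π, Δ x with hC₀
  set c := C₀ / (2 * π) with hc
  set e : ℝ := 4 * (M + 1) * ε / (3 * π) with he
  set KL : ℝ := K * (8 * π / (M + 1)) with hKL
  -- (1) the window bound for `Δ`
  have h1 : mhi - c ≤ KL + (c - mlo) / 3 + e := by
    have hw := window_bound hM hK hper hmeas hlip hlo hF hε
    have : mhi ≤ c + (KL + (c - mlo) / 3 + e) := by
      refine csSup_le hne ?_
      rintro _ ⟨x, rfl⟩
      have := hw x
      linarith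
    linarith
  -- (2) the window bound for the reflection `x ↦ -Δ(-x)`
  have h2 : c - mlo ≤ KL + (mhi - c) / 3 + e := by
    set Δ' : ℝ → ℝ := fun x => -Δ (-x) with hΔ'
    have hper' : Function.Periodic Δ' (2 * π) := by
      intro x
      simp only [hΔ']
      rw [neg_add, ← sub_eq_add_neg, hper.sub_eq]
    have hmeas' : Measurable Δ' := (hmeas.comp measurable_neg).neg
    have hlip' : ∀ t t', t ≤ t' → Δ' t - K * (t' - t) ≤ Δ' t' := by
      intro u u' huu'
      have := hlip (-u') (-u) (by linarith)
      simp only [hΔ']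
      linarith
    have hlo' : ∀ x, -mhi ≤ Δ' x := fun x => by simp only [hΔ']; linarith [hhi (-x)]
    have hcos' : ∀ d : ℕ, ∫ x in (-π)..π, Δ' x * Real.cos (d * x) =
        -∫ x in (-π)..π, Δ x * Real.cos (d * x) := by
      intro d
      have e1 : ∀ x, Δ' x * Real.cos (d * x) = (fun y => -(Δ y * Real.cos (d * y))) (-x) := by
        intro x; simp only [hΔ', mul_neg, Real.cos_neg]; ring
      simp_rw [e1]
      rw [intervalIntegral.integral_comp_neg (fun y => -(Δ y * Real.cos (d * y))), neg_neg,
        intervalIntegral.integral_neg]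
    have hsin' : ∀ d : ℕ, ∫ x in (-π)..π, Δ' x * Real.sin (d * x) =
        ∫ x in (-π)..π, Δ x * Real.sin (d * x) := by
      intro d
      have e1 : ∀ x, Δ' x * Real.sin (d * x) = (fun y => Δ y * Real.sin (d * y)) (-x) := by
        intro x; simp only [hΔ', mul_neg, Real.sin_neg]; ring
      simp_rw [e1]
      rw [intervalIntegral.integral_comp_neg (fun y => Δ y * Real.sin (d * y)), neg_neg]
    have hF' : ∀ d : ℕ, 1 ≤ d → d ≤ M →
        |∫ x in (-π)..π, Δ' x * Real.cos (d * x)| ≤ ε ∧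
          |∫ x in (-π)..π, Δ' x * Real.sin (d * x)| ≤ ε := by
      intro d hd1 hdM
      rw [hcos', hsin', abs_neg]
      exact hF d hd1 hdM
    have hC₀' : ∫ x in (-π)..π, Δ' x = -C₀ := by
      have := hcos' 0
      simpa using this
    have hw := window_bound hM hK hper' hmeas' hlip' hlo' hF' hε
    have : ∀ x, c - Δ x ≤ KL + (mhi - c) / 3 + e := by
      intro x
      have h := hw (-x)
      rw [hC₀'] at h
      simp only [hΔ', neg_neg] at h
      have e2 : -C₀ / (2 * π) = -c := by rw [hc]; ring
      rw [e2] at h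
      linarith
    have : c - (KL + (mhi - c) / 3 + e) ≤ mlo := by
      refine le_csInf hne ?_
      rintro _ ⟨x, rfl⟩
      linarith [this x]
    linarith
  -- (3) combine
  have h3 : mhi - mlo ≤ 3 * KL + 3 * e := by linarith
  have h4 : Δ t - Δ t' ≤ mhi - mlo := by linarith [hhi t, hlo t']
  have h5 : 3 * KL + 3 * e = 24 * π * K / (M + 1) + 4 * (M + 1) * ε / π := by
    rw [hKL, he]
    field_simp
    ring
  linarith

end Window

/-! ### Trigonometric integrals over a period -/

section Trig

/-- `d/dy sin(cy) = c cos(cy)`. [folklore] -/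
theorem hasDerivAt_sin_mul (c x : ℝ) :
    HasDerivAt (fun y => Real.sin (c * y)) (c * Real.cos (c * x)) x :=
  (((hasDerivAt_id' x).const_mul c).sin).congr_deriv (by ring)

/-- `d/dy cos(cy) = -c sin(cy)`. [folklore] -/
theorem hasDerivAt_cos_mul (c x : ℝ) :
    HasDerivAt (fun y => Real.cos (c * y)) (-(c * Real.sin (c * x))) x :=
  (((hasDerivAt_id' x).const_mul c).cos).congr_deriv (by ring)

/-- `∫_0^{2π} cos(du) du = 0` for `d ≥ 1`. [folklore] -/
theorem integral_cos_nat_mul_zero_two_pi {d : ℕ} (hd : d ≠ 0) :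
    ∫ u in (0 : ℝ)..(2 * π), Real.cos (d * u) = 0 := by
  have hd' : (d : ℝ) ≠ 0 := Nat.cast_ne_zero.mpr hd
  rw [intervalIntegral.integral_comp_mul_left (fun x => Real.cos x) hd', integral_cos]
  have hs : Real.sin (d * (2 * π)) = 0 := by
    rw [show (d : ℝ) * (2 * π) = ((2 * d : ℕ) : ℝ) * π by push_cast; ring, Real.sin_nat_mul_pi]
  simp [hs]

/-- `∫_0^{2π} sin(du) du = 0` for `d ≥ 1`. [folklore] -/
theorem integral_sin_nat_mul_zero_two_pi {d : ℕ} (hd : d ≠ 0) :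
    ∫ u in (0 : ℝ)..(2 * π), Real.sin (d * u) = 0 := by
  have hd' : (d : ℝ) ≠ 0 := Nat.cast_ne_zero.mpr hd
  rw [intervalIntegral.integral_comp_mul_left (fun x => Real.sin x) hd', integral_sin]
  have : Real.cos (d * (2 * π)) = 1 := by
    rw [show (d : ℝ) * (2 * π) = (d : ℕ) * (2 * π) by rfl, Real.cos_nat_mul_two_pi]
  simp [this]

/-- `∫_0^{2π} u cos(du) du = 0` for `d ≥ 1` (by parts). [folklore] -/
theorem integral_id_mul_cos {d : ℕ} (hd : d ≠ 0) :
    ∫ u in (0 : ℝ)..(2 * π), u * Real.cos (d * u) = 0 := by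
  have hd' : (d : ℝ) ≠ 0 := Nat.cast_ne_zero.mpr hd
  -- `∫ u · (d cos(du)) = [u sin(du)] - ∫ sin(du) = 0`
  have h := intervalIntegral.integral_mul_deriv_eq_deriv_mul (a := 0) (b := 2 * π)
    (u := fun y : ℝ => y) (u' := fun _ => 1) (v := fun y => Real.sin (d * y))
    (v' := fun y => d * Real.cos (d * y)) (fun x _ => hasDerivAt_id x)
    (fun x _ => hasDerivAt_sin_mul d x) intervalIntegrable_const
    ((by fun_prop : Continuous fun y : ℝ => d * Real.cos (d * y)).intervalIntegrable _ _)
  have hs : Real.sin (d * (2 * π)) = 0 := by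
    rw [show (d : ℝ) * (2 * π) = ((2 * d : ℕ) : ℝ) * π by push_cast; ring, Real.sin_nat_mul_pi]
  simp only [hs, mul_zero, mul_zero, Real.sin_zero, sub_zero, one_mul,
    integral_sin_nat_mul_zero_two_pi hd] at h
  have e : ∫ u in (0 : ℝ)..(2 * π), u * (d * Real.cos (d * u)) =
      d * ∫ u in (0 : ℝ)..(2 * π), u * Real.cos (d * u) := by
    rw [← intervalIntegral.integral_const_mul]
    refine intervalIntegral.integral_congr fun u _ => ?_
    ring
  rw [e] at h
  have : (d : ℝ) * ∫ u in (0 : ℝ)..(2 * π), u * Real.cos (d * u) = 0 := by simpa using h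
  exact (mul_eq_zero.mp this).resolve_left hd'

/-- `∫_0^{2π} u sin(du) du = -2π/d` for `d ≥ 1` (by parts). [folklore] -/
theorem integral_id_mul_sin {d : ℕ} (hd : d ≠ 0) :
    ∫ u in (0 : ℝ)..(2 * π), u * Real.sin (d * u) = -(2 * π) / d := by
  have hd' : (d : ℝ) ≠ 0 := Nat.cast_ne_zero.mpr hd
  have h := intervalIntegral.integral_mul_deriv_eq_deriv_mul (a := 0) (b := 2 * π)
    (u := fun y : ℝ => y) (u' := fun _ => 1) (v := fun y => Real.cos (d * y))
    (v' := fun y => -(d * Real.sin (d * y))) (fun x _ => hasDerivAt_id x)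
    (fun x _ => hasDerivAt_cos_mul d x) intervalIntegrable_const
    ((by fun_prop : Continuous fun y : ℝ => -(d * Real.sin (d * y))).intervalIntegrable _ _)
  have hc : Real.cos (d * (2 * π)) = 1 := by
    rw [show (d : ℝ) * (2 * π) = (d : ℕ) * (2 * π) by rfl, Real.cos_nat_mul_two_pi]
  simp only [hc, mul_one, mul_zero, Real.cos_zero, sub_zero, one_mul,
    integral_cos_nat_mul_zero_two_pi hd] at h
  have e : ∫ u in (0 : ℝ)..(2 * π), u * -(d * Real.sin (d * u)) =
      -d * ∫ u in (0 : ℝ)..(2 * π), u * Real.sin (d * u) := by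
    rw [← intervalIntegral.integral_const_mul]
    refine intervalIntegral.integral_congr fun u _ => ?_
    ring
  rw [e] at h
  rw [eq_div_iff hd']
  linarith

end Trig

/-! ### The sawtooth function -/

section Saw

/-- The left-continuous sawtooth of period `2π`: `sawtooth u = fract(-u/(2π)) - 1`, equal to
`-u/(2π)` on `(0, 2π]`; it decreases with slope `-1/(2π)` and jumps up by `1` at the multiples of
`2π`, so that `Σ_j sawtooth(t - θ_j)` is, up to the linear term, the counting function of the
points `θ_j (mod 2π)` (the classical device behind the Erdős–Turán inequality, Montgomery *Ten
lectures* Ch. 1). [folklore] -/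
noncomputable def sawtooth (u : ℝ) : ℝ := Int.fract (-u / (2 * π)) - 1

/-- `sawtooth u = -u/(2π)` for `u ∈ (0, 2π]`. [folklore] -/
theorem sawtooth_eq_of_mem {u : ℝ} (hu : u ∈ Set.Ioc 0 (2 * π)) : sawtooth u = -u / (2 * π) := by
  have h2π : (0 : ℝ) < 2 * π := by positivity
  rw [sawtooth]
  have h1 : Int.fract (-u / (2 * π)) = -u / (2 * π) + 1 := by
    rw [Int.fract_eq_iff]
    refine ⟨?_, ?_, ⟨-1, ?_⟩⟩
    · have : u / (2 * π) ≤ 1 := by rw [div_le_one h2π]; exact hu.2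
      rw [neg_div]; linarith
    · have : 0 < u / (2 * π) := div_pos hu.1 h2π
      rw [neg_div]; linarith
    · push_cast; ring
  rw [h1]; ring

/-- Closed form `sawtooth u = -u/(2π) + ⌈u/(2π)⌉ - 1`. [folklore] -/
theorem sawtooth_eq (u : ℝ) : sawtooth u = -(u / (2 * π)) + ⌈u / (2 * π)⌉ - 1 := by
  rw [sawtooth, ← Int.self_sub_floor, neg_div, Int.floor_neg]
  push_cast
  ring

/-- `sawtooth` has period `2π`. [folklore] -/
theorem sawtooth_add_two_pi (u : ℝ) : sawtooth (u + 2 * π) = sawtooth u := by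
  have h2π : (2 * π : ℝ) ≠ 0 := by positivity
  rw [sawtooth, sawtooth, show -(u + 2 * π) / (2 * π) = -u / (2 * π) - 1 by field_simp; ring,
    Int.fract_sub_one]

/-- `sawtooth` has period `2π`. [folklore] -/
theorem sawtooth_periodic : Function.Periodic sawtooth (2 * π) := sawtooth_add_two_pi

/-- `sawtooth v - sawtooth u = -(v-u)/(2π) + #{k ∈ ℤ : u ≤ 2πk < v}`, the count written as
`⌈v/(2π)⌉ - ⌈u/(2π)⌉`. [folklore] -/
theorem sawtooth_sub_sawtooth (u v : ℝ) :
    sawtooth v - sawtooth u = -((v - u) / (2 * π)) + (⌈v / (2 * π)⌉ - ⌈u / (2 * π)⌉ : ℤ) := by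
  rw [sawtooth_eq, sawtooth_eq]
  push_cast
  ring

/-- `sawtooth` decreases at rate at most `1/(2π)`. [folklore] -/
theorem sawtooth_oneSided {u v : ℝ} (huv : u ≤ v) : sawtooth u - (v - u) / (2 * π) ≤ sawtooth v := by
  have h2π : (0 : ℝ) < 2 * π := by positivity
  have h := sawtooth_sub_sawtooth u v
  have hc : (⌈u / (2 * π)⌉ : ℝ) ≤ ⌈v / (2 * π)⌉ := by
    exact_mod_cast Int.ceil_mono (div_le_div_of_nonneg_right huv h2π.le)
  push_cast at h
  linarith

/-- `|sawtooth| ≤ 1`. [folklore] -/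
theorem abs_sawtooth_le (u : ℝ) : |sawtooth u| ≤ 1 := by
  rw [sawtooth, abs_le]
  constructor <;> linarith [Int.fract_nonneg (-u / (2 * π)), Int.fract_lt_one (-u / (2 * π))]

/-- `sawtooth` is measurable. [folklore] -/
theorem measurable_sawtooth : Measurable sawtooth := by
  unfold sawtooth
  exact (measurable_fract.comp (measurable_neg.div_const _)).sub_const 1

/-- `sawtooth(φ(t)) h(t)` is integrable on intervals for measurable `φ` and continuous `h`.
[folklore] -/
theorem intervalIntegrable_sawtooth_comp_mul {h : ℝ → ℝ} (hh : Continuous h) {φ : ℝ → ℝ}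
    (hφ : Measurable φ) (a b : ℝ) :
    IntervalIntegrable (fun t => sawtooth (φ t) * h t) volume a b := by
  refine IntervalIntegrable.mul_continuousOn ?_ hh.continuousOn
  rw [intervalIntegrable_iff]
  refine Measure.integrableOn_of_bounded (M := 1) ?_
    ((measurable_sawtooth.comp hφ).aestronglyMeasurable) ?_
  · rw [Real.volume_uIoc]
    exact ENNReal.ofReal_ne_top
  · exact Filter.Eventually.of_forall fun t => by
      rw [Real.norm_eq_abs]; exact abs_sawtooth_le _

/-- `sawtooth(t) h(t)` is integrable on intervals for continuous `h`. [folklore] -/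
theorem intervalIntegrable_sawtooth_mul {h : ℝ → ℝ} (hh : Continuous h) (a b : ℝ) :
    IntervalIntegrable (fun t => sawtooth t * h t) volume a b := by
  simpa using intervalIntegrable_sawtooth_comp_mul hh measurable_id a b

/-- `∫_0^{2π} sawtooth(u) h(u) du = -(2π)⁻¹ ∫_0^{2π} u h(u) du`. [folklore] -/
theorem integral_sawtooth_mul (h : ℝ → ℝ) :
    ∫ u in (0 : ℝ)..(2 * π), sawtooth u * h u = -(1 / (2 * π)) * ∫ u in (0 : ℝ)..(2 * π), u * h u := by
  have h2π : (0 : ℝ) ≤ 2 * π := by positivity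
  rw [← intervalIntegral.integral_const_mul]
  refine intervalIntegral.integral_congr_ae (Filter.Eventually.of_forall fun u hu => ?_)
  rw [Set.uIoc_of_le h2π] at hu
  rw [sawtooth_eq_of_mem hu]
  ring

/-- `∫_0^{2π} sawtooth(u) cos(du) du = 0` (`d ≥ 1`). [folklore] -/
theorem integral_sawtooth_mul_cos {d : ℕ} (hd : d ≠ 0) :
    ∫ u in (0 : ℝ)..(2 * π), sawtooth u * Real.cos (d * u) = 0 := by
  rw [integral_sawtooth_mul, integral_id_mul_cos hd, mul_zero]

/-- `∫_0^{2π} sawtooth(u) sin(du) du = 1/d` (`d ≥ 1`): the Fourier series `Σ_{d ≥ 1} sin(du)/(πd)`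
of the sawtooth. [folklore] -/
theorem integral_sawtooth_mul_sin {d : ℕ} (hd : d ≠ 0) :
    ∫ u in (0 : ℝ)..(2 * π), sawtooth u * Real.sin (d * u) = 1 / d := by
  have hd' : (d : ℝ) ≠ 0 := Nat.cast_ne_zero.mpr hd
  rw [integral_sawtooth_mul, integral_id_mul_sin hd]
  have : (π : ℝ) ≠ 0 := Real.pi_pos.ne'
  field_simp

/-- `∫_{-π}^{π} sawtooth(t - θ) cos(dt) dt = -sin(dθ)/d` (`d ≥ 1`). [folklore] -/
theorem integral_sawtooth_sub_mul_cos {d : ℕ} (hd : d ≠ 0) (θ : ℝ) :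
    ∫ t in (-π)..π, sawtooth (t - θ) * Real.cos (d * t) = -Real.sin (d * θ) / d := by
  have hper : Function.Periodic (fun t => sawtooth (t - θ) * Real.cos (d * t)) (2 * π) := by
    intro t
    simp only
    rw [show t + 2 * π - θ = (t - θ) + 2 * π by ring, sawtooth_add_two_pi,
      show (d : ℝ) * (t + 2 * π) = d * t + (d : ℕ) * (2 * π) by ring, Real.cos_add_nat_mul_two_pi]
  have h1 := integral_periodic_shift hper (θ + π)
  rw [← h1, show θ + π - π = 0 + θ by ring, show θ + π + π = 2 * π + θ by ring,
    ← intervalIntegral.integral_comp_add_right _ θ]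
  simp only [add_sub_cancel_right]
  have e : ∀ u : ℝ, sawtooth u * Real.cos (d * (u + θ)) =
      Real.cos (d * θ) * (sawtooth u * Real.cos (d * u)) - Real.sin (d * θ) * (sawtooth u * Real.sin (d * u)) := by
    intro u; rw [mul_add, Real.cos_add]; ring
  simp_rw [e]
  rw [intervalIntegral.integral_sub
      ((intervalIntegrable_sawtooth_mul (by fun_prop) _ _).const_mul _)
      ((intervalIntegrable_sawtooth_mul (by fun_prop) _ _).const_mul _),
    intervalIntegral.integral_const_mul, intervalIntegral.integral_const_mul,
    integral_sawtooth_mul_cos hd, integral_sawtooth_mul_sin hd]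
  ring

/-- `∫_{-π}^{π} sawtooth(t - θ) sin(dt) dt = cos(dθ)/d` (`d ≥ 1`). [folklore] -/
theorem integral_sawtooth_sub_mul_sin {d : ℕ} (hd : d ≠ 0) (θ : ℝ) :
    ∫ t in (-π)..π, sawtooth (t - θ) * Real.sin (d * t) = Real.cos (d * θ) / d := by
  have hper : Function.Periodic (fun t => sawtooth (t - θ) * Real.sin (d * t)) (2 * π) := by
    intro t
    simp only
    rw [show t + 2 * π - θ = (t - θ) + 2 * π by ring, sawtooth_add_two_pi,
      show (d : ℝ) * (t + 2 * π) = d * t + (d : ℕ) * (2 * π) by ring, Real.sin_add_nat_mul_two_pi]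
  have h1 := integral_periodic_shift hper (θ + π)
  rw [← h1, show θ + π - π = 0 + θ by ring, show θ + π + π = 2 * π + θ by ring,
    ← intervalIntegral.integral_comp_add_right _ θ]
  simp only [add_sub_cancel_right]
  have e : ∀ u : ℝ, sawtooth u * Real.sin (d * (u + θ)) =
      Real.cos (d * θ) * (sawtooth u * Real.sin (d * u)) + Real.sin (d * θ) * (sawtooth u * Real.cos (d * u)) := by
    intro u; rw [mul_add, Real.sin_add]; ring
  simp_rw [e]
  rw [intervalIntegral.integral_add
      ((intervalIntegrable_sawtooth_mul (by fun_prop) _ _).const_mul _)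
      ((intervalIntegrable_sawtooth_mul (by fun_prop) _ _).const_mul _),
    intervalIntegral.integral_const_mul, intervalIntegral.integral_const_mul,
    integral_sawtooth_mul_cos hd, integral_sawtooth_mul_sin hd]
  ring

end Saw

/-! ### The normalised primitive of the density -/

section Density

variable {g : ℝ → ℝ}

/-- The normalised primitive `Ψ(t) = ∫_0^t g - t/(2π)` of a density `g` on the circle `ℝ/2πℤ` (it
is `2π`-periodic when `∫_{-π}^{π} g = 1`). [folklore] -/
noncomputable def densityPrim (g : ℝ → ℝ) (t : ℝ) : ℝ := (∫ x in (0 : ℝ)..t, g x) - t / (2 * π)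

/-- `Ψ' = g - 1/(2π)` for continuous `g`. [folklore] -/
theorem hasDerivAt_densityPrim (hg : Continuous g) (t : ℝ) :
    HasDerivAt (densityPrim g) (g t - 1 / (2 * π)) t := by
  have h1 := (hg.integral_hasStrictDerivAt 0 t).hasDerivAt
  have h2 : HasDerivAt (fun t : ℝ => t / (2 * π)) (1 / (2 * π)) t :=
    (hasDerivAt_id' t).div_const (2 * π)
  exact h1.sub h2

/-- `Ψ` is continuous. [folklore] -/
theorem continuous_densityPrim (hg : Continuous g) : Continuous (densityPrim g) :=
  (intervalIntegral.continuous_primitive (fun a b => hg.intervalIntegrable a b) 0).sub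
    (continuous_id.div_const _)

/-- `∫_t^{t+2π} g = 1` for a `2π`-periodic `g` with `∫_{-π}^{π} g = 1`. [folklore] -/
theorem integral_period (hper : Function.Periodic g (2 * π))
    (hone : ∫ x in (-π)..π, g x = 1) (t : ℝ) : ∫ x in t..t + 2 * π, g x = 1 := by
  rw [hper.intervalIntegral_add_eq t (-π), show -π + 2 * π = π by ring, hone]

/-- `Ψ` has period `2π`. [folklore] -/
theorem densityPrim_add_two_pi (hg : Continuous g) (hper : Function.Periodic g (2 * π))
    (hone : ∫ x in (-π)..π, g x = 1) (t : ℝ) : densityPrim g (t + 2 * π) = densityPrim g t := by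
  unfold densityPrim
  rw [← intervalIntegral.integral_add_adjacent_intervals (hg.intervalIntegrable 0 t)
    (hg.intervalIntegrable t (t + 2 * π)), integral_period hper hone t]
  have : (2 * π : ℝ) ≠ 0 := by positivity
  field_simp
  ring

/-- `Ψ` has period `2π`. [folklore] -/
theorem densityPrim_periodic (hg : Continuous g) (hper : Function.Periodic g (2 * π))
    (hone : ∫ x in (-π)..π, g x = 1) : Function.Periodic (densityPrim g) (2 * π) :=
  densityPrim_add_two_pi hg hper hone

/-- `Ψ(v) - Ψ(u) = ∫_u^v g - (v-u)/(2π)`. [folklore] -/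
theorem densityPrim_sub_densityPrim (hg : Continuous g) (u v : ℝ) :
    densityPrim g v - densityPrim g u = (∫ x in u..v, g x) - (v - u) / (2 * π) := by
  unfold densityPrim
  rw [← intervalIntegral.integral_interval_sub_left (hg.intervalIntegrable 0 v)
    (hg.intervalIntegrable 0 u)]
  ring

/-- `Ψ(v) - Ψ(u) ≤ (G - 1/(2π))(v - u)` for `u ≤ v` when `g ≤ G`. [folklore] -/
theorem densityPrim_oneSided (hg : Continuous g) {G : ℝ} (hG : ∀ x, g x ≤ G) {u v : ℝ} (huv : u ≤ v) :
    densityPrim g v - densityPrim g u ≤ (G - 1 / (2 * π)) * (v - u) := by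
  rw [densityPrim_sub_densityPrim hg]
  have h := intervalIntegral.integral_mono_on huv (hg.intervalIntegrable u v)
    (intervalIntegrable_const : IntervalIntegrable (fun _ => G) volume u v) (fun x _ => hG x)
  rw [intervalIntegral.integral_const, smul_eq_mul] at h
  have e : (G - 1 / (2 * π)) * (v - u) = (v - u) * G - (v - u) / (2 * π) := by ring
  rw [e]
  linarith

/-- `∫_{-π}^{π} Ψ(t) cos(dt) dt = -(1/d) ∫_{-π}^{π} g(t) sin(dt) dt` (`d ≥ 1`, integration by
parts). [folklore] -/
theorem integral_densityPrim_mul_cos (hg : Continuous g) {d : ℕ} (hd : d ≠ 0) :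
    ∫ t in (-π)..π, densityPrim g t * Real.cos (d * t) =
      -(1 / d) * ∫ t in (-π)..π, g t * Real.sin (d * t) := by
  have hd' : (d : ℝ) ≠ 0 := Nat.cast_ne_zero.mpr hd
  have hv : ∀ x : ℝ, HasDerivAt (fun y => Real.sin (d * y) / d) (Real.cos (d * x)) x := by
    intro x
    refine ((hasDerivAt_sin_mul d x).div_const d).congr_deriv ?_
    field_simp
  have h := intervalIntegral.integral_mul_deriv_eq_deriv_mul (a := -π) (b := π)
    (fun x _ => hasDerivAt_densityPrim hg x) (fun x _ => hv x)
    ((by fun_prop : Continuous fun t => g t - 1 / (2 * π)).intervalIntegrable _ _)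
    ((by fun_prop : Continuous fun t : ℝ => Real.cos (d * t)).intervalIntegrable _ _)
  rw [h]
  have hs1 : Real.sin (d * π) = 0 := Real.sin_nat_mul_pi d
  have hs2 : Real.sin (d * -π) = 0 := by rw [mul_neg, Real.sin_neg, hs1, neg_zero]
  rw [hs1, hs2]
  have e : ∀ t, (g t - 1 / (2 * π)) * (Real.sin (d * t) / d) =
      (1 / d) * (g t * Real.sin (d * t)) - (1 / (2 * π * d)) * Real.sin (d * t) := by
    intro t; field_simp
  simp_rw [e]
  rw [intervalIntegral.integral_sub (((by fun_prop : Continuous fun t => g t * Real.sin (d * t))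
      ).intervalIntegrable _ _ |>.const_mul _) ((by fun_prop : Continuous fun t : ℝ =>
      Real.sin (d * t)).intervalIntegrable _ _ |>.const_mul _),
    intervalIntegral.integral_const_mul, intervalIntegral.integral_const_mul]
  have hsin0 : ∫ t in (-π)..π, Real.sin (d * t) = 0 := by
    rw [intervalIntegral.integral_comp_mul_left (fun x => Real.sin x) hd', integral_sin]
    simp [mul_neg, Real.cos_neg]
  rw [hsin0]
  ring

/-- `∫_{-π}^{π} Ψ(t) sin(dt) dt = (1/d) ∫_{-π}^{π} g(t) cos(dt) dt` (`d ≥ 1`, integration by parts;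
the boundary term vanishes by periodicity of `Ψ`). [folklore] -/
theorem integral_densityPrim_mul_sin (hg : Continuous g) (hper : Function.Periodic g (2 * π))
    (hone : ∫ x in (-π)..π, g x = 1) {d : ℕ} (hd : d ≠ 0) :
    ∫ t in (-π)..π, densityPrim g t * Real.sin (d * t) =
      (1 / d) * ∫ t in (-π)..π, g t * Real.cos (d * t) := by
  have hd' : (d : ℝ) ≠ 0 := Nat.cast_ne_zero.mpr hd
  have hv : ∀ x : ℝ, HasDerivAt (fun y => -Real.cos (d * y) / d) (Real.sin (d * x)) x := by
    intro x
    refine (((hasDerivAt_cos_mul d x).neg).div_const d).congr_deriv ?_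
    field_simp
  have h := intervalIntegral.integral_mul_deriv_eq_deriv_mul (a := -π) (b := π)
    (fun x _ => hasDerivAt_densityPrim hg x) (fun x _ => hv x)
    ((by fun_prop : Continuous fun t => g t - 1 / (2 * π)).intervalIntegrable _ _)
    ((by fun_prop : Continuous fun t : ℝ => Real.sin (d * t)).intervalIntegrable _ _)
  rw [h]
  have hc : Real.cos (d * -π) = Real.cos (d * π) := by rw [mul_neg, Real.cos_neg]
  have hp : densityPrim g π = densityPrim g (-π) := by
    have := densityPrim_add_two_pi hg hper hone (-π)
    rwa [show -π + 2 * π = π by ring] at this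
  rw [hc, hp]
  have e : ∀ t, (g t - 1 / (2 * π)) * (-Real.cos (d * t) / d) =
      (1 / (2 * π * d)) * Real.cos (d * t) - (1 / d) * (g t * Real.cos (d * t)) := by
    intro t; field_simp; ring
  simp_rw [e]
  rw [intervalIntegral.integral_sub ((by fun_prop : Continuous fun t : ℝ =>
      Real.cos (d * t)).intervalIntegrable _ _ |>.const_mul _)
      (((by fun_prop : Continuous fun t => g t * Real.cos (d * t))
      ).intervalIntegrable _ _ |>.const_mul _),
    intervalIntegral.integral_const_mul, intervalIntegral.integral_const_mul]
  have hcos0 : ∫ t in (-π)..π, Real.cos (d * t) = 0 := by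
    have := integral_cos_int_mul (c := d) (by exact_mod_cast hd)
    exact_mod_cast this
  rw [hcos0]
  ring

end Density

/-! ### The discrepancy function of a finite family of points against a density -/

section Disc

variable {ι : Type*} [Fintype ι] {g : ℝ → ℝ}

/-- The `μ`-discrepancy function of the finite family of points `θ_j ∈ ℝ/2πℤ` against the density
`g` (Murty–Sinha §2, p. 686: `D_{I,V}(μ) = |N_I(V) - V μ(I)|`; here as the periodic function `t ↦
Σ_j sawtooth(t - θ_j) - n Ψ(t)`, `n = #ι`, whose increments are the discrepancies of arcs:
`discrepancy_sub_discrepancy`). [cite: MurtySinha2009, §2 p. 686 (definition of D_{I,V}(μ))] -/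
noncomputable def discrepancy (θ : ι → ℝ) (g : ℝ → ℝ) (t : ℝ) : ℝ :=
  ∑ j, sawtooth (t - θ j) - (Fintype.card ι : ℝ) * densityPrim g t

/-- The discrepancy function has period `2π`. [folklore] -/
theorem discrepancy_periodic (θ : ι → ℝ) (hg : Continuous g) (hper : Function.Periodic g (2 * π))
    (hone : ∫ x in (-π)..π, g x = 1) : Function.Periodic (discrepancy θ g) (2 * π) := by
  intro t
  unfold discrepancy
  rw [densityPrim_add_two_pi hg hper hone]
  congr 1
  refine Finset.sum_congr rfl fun j _ => ?_
  rw [show t + 2 * π - θ j = (t - θ j) + 2 * π by ring, sawtooth_add_two_pi]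

/-- The discrepancy function is measurable. [folklore] -/
theorem measurable_discrepancy (θ : ι → ℝ) (hg : Continuous g) : Measurable (discrepancy θ g) := by
  unfold discrepancy
  refine Measurable.sub (Finset.measurable_sum _ fun j _ => ?_)
    ((continuous_densityPrim hg).measurable.const_mul _)
  exact measurable_sawtooth.comp (measurable_id.sub_const _)

/-- The discrepancy function decreases at rate at most `nG` when `g ≤ G` (between the points it has
slope `-n g`). [folklore] -/
theorem discrepancy_oneSided (θ : ι → ℝ) (hg : Continuous g) {G : ℝ} (hG : ∀ x, g x ≤ G) {t t' : ℝ}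
    (htt' : t ≤ t') : discrepancy θ g t - Fintype.card ι * G * (t' - t) ≤ discrepancy θ g t' := by
  unfold discrepancy
  have h1 : ∀ j, sawtooth (t - θ j) - (t' - t) / (2 * π) ≤ sawtooth (t' - θ j) := by
    intro j
    have := sawtooth_oneSided (u := t - θ j) (v := t' - θ j) (by linarith)
    rwa [show t' - θ j - (t - θ j) = t' - t by ring] at this
  have h2 : ∑ j, sawtooth (t - θ j) - Fintype.card ι * ((t' - t) / (2 * π)) ≤ ∑ j, sawtooth (t' - θ j) := by
    have := Finset.sum_le_sum fun j (_ : j ∈ Finset.univ) => h1 j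
    rw [Finset.sum_sub_distrib, Finset.sum_const, Finset.card_univ, nsmul_eq_mul] at this
    exact this
  have h3 := densityPrim_oneSided hg hG htt'
  have hn : (0 : ℝ) ≤ Fintype.card ι := Nat.cast_nonneg _
  have h4 := mul_le_mul_of_nonneg_left h3 hn
  have e1 : (Fintype.card ι : ℝ) * ((G - 1 / (2 * π)) * (t' - t)) =
      Fintype.card ι * G * (t' - t) - Fintype.card ι * ((t' - t) / (2 * π)) := by ring
  have e2 : (Fintype.card ι : ℝ) * (densityPrim g t' - densityPrim g t) =
      Fintype.card ι * densityPrim g t' - Fintype.card ι * densityPrim g t := by ring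
  rw [e1, e2] at h4
  linarith

/-- Increments of the discrepancy function: `D(v) - D(u) = #{(j,k) : u ≤ θ_j + 2πk < v} - n ∫_u^v
g`, the count written as `Σ_j (⌈(v-θ_j)/(2π)⌉ - ⌈(u-θ_j)/(2π)⌉)`. [folklore] -/
theorem discrepancy_sub_discrepancy (θ : ι → ℝ) (hg : Continuous g) (u v : ℝ) :
    discrepancy θ g v - discrepancy θ g u =
      (∑ j, (⌈(v - θ j) / (2 * π)⌉ - ⌈(u - θ j) / (2 * π)⌉ : ℤ) : ℝ) -
        Fintype.card ι * ∫ x in u..v, g x := by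
  unfold discrepancy
  have h1 : ∀ j, sawtooth (v - θ j) - sawtooth (u - θ j) =
      -((v - u) / (2 * π)) + (⌈(v - θ j) / (2 * π)⌉ - ⌈(u - θ j) / (2 * π)⌉ : ℤ) := by
    intro j
    rw [sawtooth_sub_sawtooth, show v - θ j - (u - θ j) = v - u by ring]
  have h2 : ∑ j, sawtooth (v - θ j) - ∑ j, sawtooth (u - θ j) =
      -(Fintype.card ι * ((v - u) / (2 * π))) +
        (∑ j, (⌈(v - θ j) / (2 * π)⌉ - ⌈(u - θ j) / (2 * π)⌉ : ℤ) : ℝ) := by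
    rw [← Finset.sum_sub_distrib, Finset.sum_congr rfl fun j _ => h1 j, Finset.sum_add_distrib,
      Finset.sum_const, Finset.card_univ, nsmul_eq_mul]
    push_cast
    ring
  have h3 := densityPrim_sub_densityPrim hg u v
  push_cast at h2 ⊢
  linear_combination h2 - (Fintype.card ι : ℝ) * h3

/-- Fourier–Stieltjes data of the discrepancy function: `∫_{-π}^{π} D(t) cos(dt) dt = -(1/d)(Σ_j
sin(dθ_j) - n ∫_{-π}^{π} g sin(d·))` (`d ≥ 1`). [folklore] -/
theorem integral_discrepancy_mul_cos (θ : ι → ℝ) (hg : Continuous g) {d : ℕ} (hd : d ≠ 0) :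
    ∫ t in (-π)..π, discrepancy θ g t * Real.cos (d * t) =
      -(1 / d) * (∑ j, Real.sin (d * θ j) - Fintype.card ι * ∫ t in (-π)..π, g t * Real.sin (d * t)) := by
  unfold discrepancy
  simp_rw [sub_mul, Finset.sum_mul]
  have hi : ∀ j, IntervalIntegrable (fun t => sawtooth (t - θ j) * Real.cos (d * t)) volume (-π) π :=
    fun j => intervalIntegrable_sawtooth_comp_mul (by fun_prop) (measurable_id.sub_const _) _ _
  have hp : IntervalIntegrable (fun t => Fintype.card ι * densityPrim g t * Real.cos (d * t))
      volume (-π) π :=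
    ((by fun_prop : Continuous fun t => (Fintype.card ι : ℝ) * Real.cos (d * t)).mul
      (continuous_densityPrim hg)).intervalIntegrable _ _ |>.congr fun t _ => by
        simp only [Pi.mul_apply]; ring
  have hsum : IntervalIntegrable (fun t => ∑ j, sawtooth (t - θ j) * Real.cos (d * t)) volume (-π) π := by
    have := IntervalIntegrable.sum Finset.univ fun j (_ : j ∈ Finset.univ) => hi j
    rwa [Finset.sum_fn] at this
  rw [intervalIntegral.integral_sub hsum hp, intervalIntegral.integral_finsetSum fun j _ => hi j]
  simp_rw [integral_sawtooth_sub_mul_cos hd]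
  have e : ∫ t in (-π)..π, Fintype.card ι * densityPrim g t * Real.cos (d * t) =
      Fintype.card ι * ∫ t in (-π)..π, densityPrim g t * Real.cos (d * t) := by
    rw [← intervalIntegral.integral_const_mul]
    refine intervalIntegral.integral_congr fun t _ => ?_
    ring
  rw [e, integral_densityPrim_mul_cos hg hd, mul_sub, Finset.mul_sum]
  congr 1
  · refine Finset.sum_congr rfl fun j _ => ?_
    ring
  · ring

/-- Fourier–Stieltjes data of the discrepancy function: `∫_{-π}^{π} D(t) sin(dt) dt = (1/d)(Σ_j
cos(dθ_j) - n ∫_{-π}^{π} g cos(d·))` (`d ≥ 1`). [folklore] -/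
theorem integral_discrepancy_mul_sin (θ : ι → ℝ) (hg : Continuous g) (hper : Function.Periodic g (2 * π))
    (hone : ∫ x in (-π)..π, g x = 1) {d : ℕ} (hd : d ≠ 0) :
    ∫ t in (-π)..π, discrepancy θ g t * Real.sin (d * t) =
      (1 / d) * (∑ j, Real.cos (d * θ j) - Fintype.card ι * ∫ t in (-π)..π, g t * Real.cos (d * t)) := by
  unfold discrepancy
  simp_rw [sub_mul, Finset.sum_mul]
  have hi : ∀ j, IntervalIntegrable (fun t => sawtooth (t - θ j) * Real.sin (d * t)) volume (-π) π :=
    fun j => intervalIntegrable_sawtooth_comp_mul (by fun_prop) (measurable_id.sub_const _) _ _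
  have hp : IntervalIntegrable (fun t => Fintype.card ι * densityPrim g t * Real.sin (d * t))
      volume (-π) π :=
    ((by fun_prop : Continuous fun t => (Fintype.card ι : ℝ) * Real.sin (d * t)).mul
      (continuous_densityPrim hg)).intervalIntegrable _ _ |>.congr fun t _ => by
        simp only [Pi.mul_apply]; ring
  have hsum : IntervalIntegrable (fun t => ∑ j, sawtooth (t - θ j) * Real.sin (d * t)) volume (-π) π := by
    have := IntervalIntegrable.sum Finset.univ fun j (_ : j ∈ Finset.univ) => hi j
    rwa [Finset.sum_fn] at this
  rw [intervalIntegral.integral_sub hsum hp, intervalIntegral.integral_finsetSum fun j _ => hi j]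
  simp_rw [integral_sawtooth_sub_mul_sin hd]
  have e : ∫ t in (-π)..π, Fintype.card ι * densityPrim g t * Real.sin (d * t) =
      Fintype.card ι * ∫ t in (-π)..π, densityPrim g t * Real.sin (d * t) := by
    rw [← intervalIntegral.integral_const_mul]
    refine intervalIntegral.integral_congr fun t _ => ?_
    ring
  rw [e, integral_densityPrim_mul_sin hg hper hone hd, mul_sub, Finset.mul_sum]
  congr 1
  · refine Finset.sum_congr rfl fun j _ => ?_
    ring
  · ring

/-- **Erdős–Turán inequality for the `μ`-discrepancy (Murty–Sinha Thm. 8, variant).** Let `g` be a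
continuous `2π`-periodic density (`∫_{-π}^{π} g = 1`, `g ≤ G`, `G ≥ 0`), `θ_j` (`j ∈ ι`, `n = #ι`)
real numbers, `M ≥ 0`, `ε ≥ 0`, and suppose the Weyl sums satisfy `|Σ_j cos(dθ_j) - n ∫_{-π}^{π} g
cos(d·)| ≤ ε` and `|Σ_j sin(dθ_j) - n ∫_{-π}^{π} g sin(d·)| ≤ ε` for `1 ≤ d ≤ M`. Then for all real
`u, v` the number of `(j, k) ∈ ι × ℤ` with `u ≤ θ_j + 2πk < v` differs from `n ∫_u^v g` by at most
`24π nG/(M+1) + 4(M+1)ε/π`. Murty–Sinha's Thm. 8 (p. 686) is the same statement with the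
Beurling–Selberg constants `V‖μ‖/(M+1) + Σ_{1≤|m|≤M} (1/(M+1) + min(b-a, 1/π|m|)) |Σ_n e(m x_n) - V
c_m|`; the present constants come from the Fejér-kernel proof (`oscillation_le_of_fourier`) and are
immaterial for Thm. 2. [cite: MurtySinha2009, Thm. 8 p. 686 (variant)] -/
theorem abs_ceilCount_sub_integral_le (θ : ι → ℝ) (hg : Continuous g)
    (hper : Function.Periodic g (2 * π)) (hone : ∫ x in (-π)..π, g x = 1) {G : ℝ} (hG0 : 0 ≤ G)
    (hG : ∀ x, g x ≤ G) {M : ℕ} {ε : ℝ} (hε : 0 ≤ ε)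
    (hF : ∀ d : ℕ, 1 ≤ d → d ≤ M →
      |∑ j, Real.cos (d * θ j) - Fintype.card ι * ∫ t in (-π)..π, g t * Real.cos (d * t)| ≤ ε ∧
      |∑ j, Real.sin (d * θ j) - Fintype.card ι * ∫ t in (-π)..π, g t * Real.sin (d * t)| ≤ ε)
    (u v : ℝ) :
    |(∑ j, (⌈(v - θ j) / (2 * π)⌉ - ⌈(u - θ j) / (2 * π)⌉ : ℤ) : ℝ) -
        Fintype.card ι * ∫ x in u..v, g x|
      ≤ 24 * π * (Fintype.card ι * G) / (M + 1) + 4 * (M + 1) * ε / π := by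
  rw [← discrepancy_sub_discrepancy θ hg u v]
  have hK : 0 ≤ (Fintype.card ι : ℝ) * G := by positivity
  have hlip : ∀ t t', t ≤ t' → discrepancy θ g t - Fintype.card ι * G * (t' - t) ≤ discrepancy θ g t' :=
    fun t t' h => discrepancy_oneSided θ hg hG h
  have hF' : ∀ d : ℕ, 1 ≤ d → d ≤ M →
      |∫ t in (-π)..π, discrepancy θ g t * Real.cos (d * t)| ≤ ε ∧
        |∫ t in (-π)..π, discrepancy θ g t * Real.sin (d * t)| ≤ ε := by
    intro d hd1 hdM
    have hd : d ≠ 0 := by omega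
    have hd' : (1 : ℝ) ≤ d := by exact_mod_cast hd1
    have hdpos : (0 : ℝ) < d := by positivity
    have h1d : 1 / (d : ℝ) ≤ 1 := by rw [div_le_one hdpos]; exact hd'
    have h1d0 : 0 ≤ 1 / (d : ℝ) := by positivity
    obtain ⟨hc, hs⟩ := hF d hd1 hdM
    constructor
    · rw [integral_discrepancy_mul_cos θ hg hd, abs_mul, abs_neg, abs_of_nonneg h1d0]
      calc 1 / (d : ℝ) * _ ≤ 1 * ε := mul_le_mul h1d hs (abs_nonneg _) zero_le_one
        _ = ε := one_mul ε
    · rw [integral_discrepancy_mul_sin θ hg hper hone hd, abs_mul, abs_of_nonneg h1d0]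
      calc 1 / (d : ℝ) * _ ≤ 1 * ε := mul_le_mul h1d hc (abs_nonneg _) zero_le_one
        _ = ε := one_mul ε
  have h1 := oscillation_le_of_fourier hK (discrepancy_periodic θ hg hper hone) (measurable_discrepancy θ hg)
    hlip hF' hε v u
  have h2 := oscillation_le_of_fourier hK (discrepancy_periodic θ hg hper hone) (measurable_discrepancy θ hg)
    hlip hF' hε u v
  rw [abs_le]
  constructor <;> linarith

end Disc

end Literature.Analysis.Fourier
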